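import Summits.HodgeConjecture.HodgeConjecture.Theorems.Ring2AbelianAllWeilComponentsDescent
import HarnessLib

/-!
# Ring 2 · AbelianAll (ab-weil-1, gen 7, part 1/4) — the SIGN CHARACTER of `ℚ^×/Nm(K_d^×)`

research route, not a corollary; conditional on HC_CM plus one named minimal statement.
Cell line: research route conditional on HC_CM; not a corollary; Q11.4-sentence-2 already refuted in dim ≥ 3.
`HC_CM` (`Theses.RankFourFaces.CMAbelianHodge`) does not occur in this file, and no open case of the
Hodge conjecture is claimed. This part is arithmetic only: the norm form of `K_d = ℚ[X]/(X² + d)` and the sign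
character of van Geemen's discriminant group `ℚ^×/Nm(K_d^×)` (LNM 1594, 4.14, Lemma 5.2 (3)–(4);
Markman §1.1), used in part 3 (`Ring2AbelianAllWeilSignature`) to read Lemma 5.2 (4)
"`H` has signature `(n, n)`" as `sign det H = (-1)ⁿ` on the tree's typed components
`Ring2.Hypotheses.WeilClassesComponent n d δ`, `δ ∈ ℚ^×/Nm(K_d^×)`.

## What is proved (0 sorry)

* §1 `norm_weilField_mk` — `Nm(a + b√-d) = a² + d·b²`; norms of units of `K_d` are positive
  (`norm_weilField_units_pos`), so `Nm(K_d^×)·` preserves signs and the sign of a rational number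
  descends to a character `weilSign d : ℚ^×/Nm(K_d^×) →* ℤˣ` (`weilSign_mk`, `weilSign_eq_one_or`);
  the split class `[(-1)ⁿ]` (`Ring2.Hypotheses.splitDiscriminantClass`) has sign `(-1)ⁿ`
  (`weilSign_splitDiscriminantClass`), and `weilSign` is compatible with the gen-6 identification
  `ℚ^×/Nm(K_{m²d}^×) = ℚ^×/Nm(K_d^×)` (`weilSign_congr`, via `weilNormResidueGroupCongr`).
* §1b `exists_ringHom_weilField_sqrt` — the embedding `K_d → ℂ`, `√-d ↦ i√d`; and the sign
  bookkeeping `neg_one_pow_mul_pos_of_det_eq` used at the end of the signature computation.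

No Literature fact is introduced; nothing here is specific to abelian varieties.

## References

* [vanGeemen1994HodgeAV] B. van Geemen, An introduction to the Hodge conjecture for abelian varieties,
  LNM 1594 (1994), 4.9, 4.14, Lemma 5.2 (1)–(4), (5.4.1).
* [Markman2025SecantWeil] E. Markman, arXiv:2502.03415 (preprint, unrefereed), §1.1 (the discriminant
  invariant `det H ∈ ℚ^×/Nm(K^×)`).
* [VoisinHodgeI2002] C. Voisin, Hodge Theory and Complex Algebraic Geometry I, Thm. 6.32, §7.1.2.
* [Deligne1982HodgeCycles] P. Deligne, Hodge cycles on abelian varieties, LNM 900, proof of Thm. 4.8.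
-/

noncomputable section

set_option linter.dupNamespace false

open CategoryTheory Polynomial
open Literature.AlgebraicGeometry Literature.AlgebraicGeometry.Motives
open Literature.AlgebraicGeometry.HodgeTheory
open Literature.AlgebraicGeometry.VanGeemen1994
open Literature.AlgebraicTopology.SingularHomology
open Summit.HodgeConjecture.HodgeConjecture.WeilTypeLadder
open Summit.HodgeConjecture.HodgeConjecture.Ring2.Hypotheses

namespace Summit.HodgeConjecture.HodgeConjecture.Ring2.AbelianAll

/-! ### §1 The sign character of `ℚ^×/Nm(K_d^×)` -/

/-- `X² + d` is monic. [folklore] -/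
theorem weilPoly_monic (d : ℕ) : (X ^ 2 + C (d : ℚ) : ℚ[X]).Monic := monic_X_pow_add_C _ two_ne_zero

/-- Reduction of a polynomial modulo `X² + d` to an explicit linear remainder. [folklore] -/
private theorem modByMonic_weil_eq (d : ℕ) {q : ℚ[X]} (a b k : ℚ)
    (h : q - (C b * X + C a) = (X ^ 2 + C (d : ℚ)) * C k) : q %ₘ (X ^ 2 + C (d : ℚ)) = C b * X + C a := by
  rw [modByMonic_eq_of_dvd_sub (weilPoly_monic d) (Dvd.intro _ h.symm),
    modByMonic_eq_self_iff (weilPoly_monic d), degree_X_pow_add_C two_pos]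
  exact degree_linear_le.trans_lt (by exact_mod_cast one_lt_two)

/-- **The norm form of `K_d = ℚ[X]/(X² + d)`: `Nm(a + b√-d) = a² + d·b²`** (determinant of
multiplication by `a + bX` on the basis `1, X`: `|a, -db; b, a|`). [cite: vanGeemen1994HodgeAV, 4.14] -/
theorem norm_weilField_mk (d : ℕ) (a b : ℚ) :
    Algebra.norm ℚ (AdjoinRoot.mk (X ^ 2 + C (d : ℚ)) (C b * X + C a)) = a ^ 2 + (d : ℚ) * b ^ 2 := by
  classical
  have hg : (X ^ 2 + C (d : ℚ) : ℚ[X]).Monic := weilPoly_monic d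
  set pb : PowerBasis ℚ (weilField d) := AdjoinRoot.powerBasis' hg with hpb
  have hdim : pb.dim = 2 := by rw [hpb, AdjoinRoot.powerBasis'_dim, natDegree_X_pow_add_C]
  set p : ℚ[X] := C b * X + C a with hp
  have r0 : p %ₘ (X ^ 2 + C (d : ℚ)) = C b * X + C a := modByMonic_weil_eq d a b 0 (by rw [hp]; simp)
  have r1 : (p * X) %ₘ (X ^ 2 + C (d : ℚ)) = C a * X + C (-((d : ℚ) * b)) :=
    modByMonic_weil_eq d _ a b (by rw [hp]; simp only [C_neg, C_mul, map_natCast]; ring)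
  have repr_mk : ∀ (f : ℚ[X]) (i : Fin pb.dim),
      pb.basis.repr (AdjoinRoot.mk (X ^ 2 + C (d : ℚ)) f) i = (f %ₘ (X ^ 2 + C (d : ℚ))).coeff i := by
    intro f i
    change (AdjoinRoot.powerBasisAux' hg).repr _ i = _
    rw [AdjoinRoot.powerBasisAux'_repr_apply_to_fun, AdjoinRoot.modByMonicHom_mk]
  have lmm : ∀ i j : Fin pb.dim, Algebra.leftMulMatrix pb.basis (AdjoinRoot.mk (X ^ 2 + C (d : ℚ)) p) i j =
      ((p * X ^ (j : ℕ)) %ₘ (X ^ 2 + C (d : ℚ))).coeff i := by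
    intro i j
    rw [Algebra.leftMulMatrix_eq_repr_mul, PowerBasis.basis_eq_pow,
      show pb.gen = AdjoinRoot.mk (X ^ 2 + C (d : ℚ)) X from (AdjoinRoot.mk_X).symm, ← map_pow, ← map_mul,
      repr_mk]
  set e := finCongr hdim with he
  have hv : ∀ j : Fin 2, ((e.symm j : Fin pb.dim) : ℕ) = (j : ℕ) := fun j => rfl
  have hent : ∀ i j : Fin 2,
      Algebra.leftMulMatrix (pb.basis.reindex e) (AdjoinRoot.mk (X ^ 2 + C (d : ℚ)) p) i j =
        ((p * X ^ (j : ℕ)) %ₘ (X ^ 2 + C (d : ℚ))).coeff (i : ℕ) := by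
    intro i j
    rw [Algebra.leftMulMatrix_eq_repr_mul, Module.Basis.reindex_apply, Module.Basis.repr_reindex_apply,
      ← Algebra.leftMulMatrix_eq_repr_mul, lmm, hv, hv]
  have hdet := Algebra.norm_eq_matrix_det (pb.basis.reindex e) (AdjoinRoot.mk (X ^ 2 + C (d : ℚ)) p)
  rw [Matrix.det_fin_two] at hdet
  simp only [hent, Fin.val_zero, Fin.val_one, pow_zero, mul_one, pow_one, r0, r1, coeff_add, coeff_C_mul,
    coeff_X, coeff_C] at hdet
  norm_num at hdet
  rw [hdet]
  ring

/-- Every element of `K_d` is `a + b√-d`, i.e. the class of a linear polynomial. [folklore] -/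
theorem exists_eq_mk_linear (d : ℕ) (k : weilField d) :
    ∃ a b : ℚ, k = AdjoinRoot.mk (X ^ 2 + C (d : ℚ)) (C b * X + C a) := by
  obtain ⟨p, rfl⟩ := AdjoinRoot.mk_surjective k
  have hg := weilPoly_monic d
  refine ⟨(p %ₘ (X ^ 2 + C (d : ℚ))).coeff 0, (p %ₘ (X ^ 2 + C (d : ℚ))).coeff 1, ?_⟩
  have hdeg : (p %ₘ (X ^ 2 + C (d : ℚ))).degree ≤ 1 := by
    have h := natDegree_modByMonic_lt p hg (by
      intro h1
      have := congrArg natDegree h1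
      rw [natDegree_X_pow_add_C, natDegree_one] at this
      exact two_ne_zero this)
    rw [natDegree_X_pow_add_C] at h
    exact degree_le_of_natDegree_le (Nat.le_of_lt_succ h)
  have hmk : AdjoinRoot.mk (X ^ 2 + C (d : ℚ)) p = AdjoinRoot.mk (X ^ 2 + C (d : ℚ)) (p %ₘ (X ^ 2 + C (d : ℚ))) := by
    rw [AdjoinRoot.mk_eq_mk]
    refine ⟨p /ₘ (X ^ 2 + C (d : ℚ)), ?_⟩
    have := modByMonic_add_div p (X ^ 2 + C (d : ℚ))
    linear_combination -this
  rw [hmk]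
  congr 1
  exact eq_X_add_C_of_degree_le_one hdeg

/-- **Norms from `K_d` are non-negative** (`Nm(a + b√-d) = a² + d b² ≥ 0`). [cite: vanGeemen1994HodgeAV, 4.14] -/
theorem norm_weilField_nonneg (d : ℕ) (k : weilField d) : 0 ≤ Algebra.norm ℚ k := by
  obtain ⟨a, b, rfl⟩ := exists_eq_mk_linear d k
  rw [norm_weilField_mk]
  positivity

/-- **Norms of units of `K_d` are positive rationals** (`Nm(K_d^×) ⊆ ℚ_{>0}`). [cite: vanGeemen1994HodgeAV, 4.14] -/
theorem norm_weilField_units_pos (d : ℕ) (k : (weilField d)ˣ) : 0 < Algebra.norm ℚ (k : weilField d) :=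
  lt_of_le_of_ne (norm_weilField_nonneg d _) ((k.isUnit.map (Algebra.norm ℚ)).ne_zero).symm

/-- Members of `Nm(K_d^×) ≤ ℚ^×` are positive. [cite: vanGeemen1994HodgeAV, 4.14] -/
theorem pos_of_mem_normUnitsSubgroup_weilField {d : ℕ} {u : ℚˣ} (hu : u ∈ normUnitsSubgroup ℚ (weilField d)) :
    0 < (u : ℚ) := by
  obtain ⟨k, hk⟩ := mem_normUnitsSubgroup_iff.1 hu
  rw [← hk]
  exact norm_weilField_units_pos d k

/-- **The sign homomorphism `ℚ^× → {±1}`.** [folklore] -/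
def ratSign : ℚˣ →* ℤˣ where
  toFun q := if 0 < (q : ℚ) then 1 else -1
  map_one' := by simp
  map_mul' q r := by
    simp only [Units.val_mul]
    rcases lt_or_gt_of_ne q.ne_zero with hq | hq <;> rcases lt_or_gt_of_ne r.ne_zero with hr | hr
    · rw [if_pos (mul_pos_of_neg_of_neg hq hr), if_neg (not_lt.2 hq.le), if_neg (not_lt.2 hr.le)]; simp
    · rw [if_neg (not_lt.2 (mul_neg_of_neg_of_pos hq hr).le), if_neg (not_lt.2 hq.le), if_pos hr]; simp
    · rw [if_neg (not_lt.2 (mul_neg_of_pos_of_neg hq hr).le), if_pos hq, if_neg (not_lt.2 hr.le)]; simp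
    · rw [if_pos (mul_pos hq hr), if_pos hq, if_pos hr]; simp

/-- `ratSign q = 1 ↔ q > 0`. [folklore] -/
theorem ratSign_eq_one_iff (q : ℚˣ) : ratSign q = 1 ↔ 0 < (q : ℚ) := by
  change (if 0 < (q : ℚ) then (1 : ℤˣ) else -1) = 1 ↔ _
  by_cases h : 0 < (q : ℚ)
  · simp [h]
  · simp only [h, iff_false]; decide

/-- `ratSign q = -1 ↔ q < 0`. [folklore] -/
theorem ratSign_eq_neg_one_iff (q : ℚˣ) : ratSign q = -1 ↔ (q : ℚ) < 0 := by
  change (if 0 < (q : ℚ) then (1 : ℤˣ) else -1) = -1 ↔ _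
  by_cases h : 0 < (q : ℚ)
  · simp only [h, if_true, not_lt.2 h.le, iff_false]; decide
  · simp only [h, if_false, true_iff]
    exact lt_of_le_of_ne (not_lt.1 h) q.ne_zero

/-- `ratSign (-1) = -1`. [folklore] -/
@[simp] theorem ratSign_neg_one : ratSign (-1) = -1 :=
  (ratSign_eq_neg_one_iff _).2 (by simp)

/-- `ratSign q = (-1)ⁿ ↔ (-1)ⁿ q > 0`. [folklore] -/
theorem ratSign_eq_neg_one_pow_iff (q : ℚˣ) (n : ℕ) : ratSign q = (-1) ^ n ↔ 0 < (-1 : ℚ) ^ n * q := by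
  rcases Nat.even_or_odd n with hn | hn
  · rw [show ((-1 : ℤˣ) ^ n) = 1 from hn.neg_one_pow, show ((-1 : ℚ) ^ n) = 1 from hn.neg_one_pow, one_mul,
      ratSign_eq_one_iff]
  · rw [show ((-1 : ℤˣ) ^ n) = -1 from hn.neg_one_pow, show ((-1 : ℚ) ^ n) = -1 from hn.neg_one_pow,
      ratSign_eq_neg_one_iff, neg_one_mul, neg_pos]

/-- `Nm(K_d^×)` lies in the kernel of the sign. [cite: vanGeemen1994HodgeAV, 4.14] -/
theorem normUnitsSubgroup_weilField_le_ker (d : ℕ) : normUnitsSubgroup ℚ (weilField d) ≤ ratSign.ker :=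
  fun _ hu => (ratSign_eq_one_iff _).2 (pos_of_mem_normUnitsSubgroup_weilField hu)

/-- **The sign character `sign : ℚ^×/Nm(K_d^×) → {±1}`** — norms from `K_d` are positive, so the sign of a
representative is an invariant of the norm residue class; `det H` "has a sign". (Van Geemen 4.14: the
group `ℚ^×/Nm(K^×)` is infinite `2`-torsion; the sign is its archimedean component.)
[cite: vanGeemen1994HodgeAV, 4.14 and Lemma 5.2 (4)] -/
def weilSign (d : ℕ) : weilNormResidueGroup d →* ℤˣ :=
  QuotientGroup.lift (normUnitsSubgroup ℚ (weilField d)) ratSign (normUnitsSubgroup_weilField_le_ker d)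

/-- `sign [q] = sign q`. [cite: vanGeemen1994HodgeAV, 4.14] -/
@[simp] theorem weilSign_mk (d : ℕ) (q : ℚˣ) :
    weilSign d (QuotientGroup.mk q : weilNormResidueGroup d) = ratSign q :=
  QuotientGroup.lift_mk' _ _ q

/-- `sign δ ∈ {1, -1}`. [folklore] -/
theorem weilSign_eq_one_or (d : ℕ) (δ : weilNormResidueGroup d) : weilSign d δ = 1 ∨ weilSign d δ = -1 :=
  Int.units_eq_one_or _

/-- **The split class has the expected sign: `sign [(-1)ⁿ] = (-1)ⁿ`.** [cite: vanGeemen1994HodgeAV, 5.4] -/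
@[simp] theorem weilSign_splitDiscriminantClass (n d : ℕ) :
    weilSign d (splitDiscriminantClass n d) = (-1) ^ n := by
  rw [splitDiscriminantClass, weilSign_mk, map_pow, ratSign_neg_one]; rfl

/-- The sign is compatible with the change of generator `ℚ^×/Nm(K_{m²d}^×) ≅ ℚ^×/Nm(K_d^×)` of gen 6
(`weilNormResidueGroupCongr`, identity on representatives). [cite: vanGeemen1994HodgeAV, 4.14] -/
@[simp] theorem weilSign_congr {m : ℕ} (hm : m ≠ 0) (d : ℕ) (δ : weilNormResidueGroup (m ^ 2 * d)) :
    weilSign d (weilNormResidueGroupCongr hm d δ) = weilSign (m ^ 2 * d) δ := by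
  induction δ using QuotientGroup.induction_on with
  | H q => rw [weilNormResidueGroupCongr_mk, weilSign_mk, weilSign_mk]

/-- `sign [q] = (-1)ⁿ ↔ (-1)ⁿ q > 0`. [folklore] -/
theorem weilSign_mk_eq_neg_one_pow_iff (d : ℕ) (q : ℚˣ) (n : ℕ) :
    weilSign d (QuotientGroup.mk q) = (-1) ^ n ↔ 0 < (-1 : ℚ) ^ n * q := by
  rw [weilSign_mk, ratSign_eq_neg_one_pow_iff]


/-! ### §1b The embedding `K_d → ℂ`, `√-d ↦ i√d`, and the sign bookkeeping of §3 -/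

/-- **An embedding `σ : K_d = ℚ[X]/(X² + d) → ℂ` with `σ(√-d) = i√d`**, `ℚ`-linear. [folklore] -/
theorem exists_ringHom_weilField_sqrt (d : ℕ) : ∃ σ : weilField d →+* ℂ,
    σ (weilSqrt d) = Complex.I * (Real.sqrt d : ℂ) ∧ ∀ r : ℚ, σ (algebraMap ℚ (weilField d) r) = (r : ℂ) := by
  have hroot : eval₂ (algebraMap ℚ ℂ) (Complex.I * (Real.sqrt d : ℂ)) (X ^ 2 + C (d : ℚ) : ℚ[X]) = 0 := by
    rw [eval₂_add, eval₂_X_pow, eval₂_C, map_natCast, I_mul_sqrt_sq, neg_add_cancel]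
  refine ⟨AdjoinRoot.lift (algebraMap ℚ ℂ) _ hroot, AdjoinRoot.lift_root hroot, fun r => ?_⟩
  rw [AdjoinRoot.algebraMap_eq, AdjoinRoot.lift_of, eq_ratCast]

/-- **Sign bookkeeping for Lemma 5.2 (4)**: if `r₀^{2n} · G = (-1)ⁿ · r` with `r > 0`, `r₀ ∈ ℝ^×`, and
`q = ((2ε)⁻¹ i)^{2n} · G` with `ε² = -d`, `d ≥ 1` (so `((2ε)⁻¹ i)^{2n} = (4d)^{-n} > 0`), then
`(-1)ⁿ q > 0`. [folklore] -/
theorem neg_one_pow_mul_pos_of_det_eq {n d : ℕ} (hd : 0 < d) {ε r₀ G : ℂ} {ρ r : ℝ}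
    (hε2 : ε * ε = -(d : ℂ)) (hρ : (ρ : ℂ) = r₀) (hρ0 : ρ ≠ 0) (hr : 0 < r)
    (hdetG : r₀ ^ (2 * n) * G = (-1) ^ n * r) {q : ℚ}
    (hdetC : ((q : ℚ) : ℂ) = ((2 * ε)⁻¹ * Complex.I) ^ (2 * n) * G) : 0 < (-1 : ℚ) ^ n * q := by
  have hc2 : ((2 * ε)⁻¹ * Complex.I) ^ (2 * n) = ((4 * (d : ℂ))⁻¹) ^ n := by
    rw [pow_mul, mul_pow, inv_pow, Complex.I_sq,
      show (2 * ε) ^ 2 = -(4 * (d : ℂ)) by rw [mul_pow, sq ε, hε2]; ring, inv_neg, neg_mul, mul_neg_one,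
      neg_neg]
  rw [hc2] at hdetC
  have hnn : ((-1 : ℂ) ^ n) * (-1) ^ n = 1 := by rw [← mul_pow, neg_one_mul, neg_neg, one_pow]
  have key : ((-1 : ℝ) ^ n * (q : ℝ)) * ρ ^ (2 * n) = ((4 * (d : ℝ))⁻¹) ^ n * r := by
    apply Complex.ofReal_injective
    push_cast
    rw [hρ, hdetC]
    linear_combination ((4 * (d : ℂ))⁻¹) ^ n * (-1) ^ n * hdetG + (((4 * (d : ℂ))⁻¹) ^ n * r) * hnn
  have hρpow : 0 < ρ ^ (2 * n) := Even.pow_pos (even_two_mul n) hρ0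
  have hrhs : 0 < ((4 * (d : ℝ))⁻¹) ^ n * r :=
    mul_pos (pow_pos (inv_pos.2 (mul_pos four_pos (Nat.cast_pos.2 hd))) n) hr
  rw [← key, mul_pos_iff_of_pos_right hρpow] at hrhs
  exact_mod_cast hrhs

end Summit.HodgeConjecture.HodgeConjecture.Ring2.AbelianAll

end
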